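import Literature.MathematicalPhysics.QuantumFieldTheory.Balaban1983to89.Node00.BetaTransportComparison
import Literature.MathematicalPhysics.QuantumFieldTheory.Balaban1983to89.Node00.CanonicalTransportOfRecord
import Literature.MathematicalPhysics.QuantumFieldTheory.Balaban1983to89.Node00.Record13NumericsOfThm1CCMWZB

/-!
# K0⁷ — RADIUS BLINDNESS OF THE β OF RECORD MODULO ITS READ SET (the corrected form (T2″) of seat -3's idea stub `stub_beta13_radiusBlind`)

Cell `pub-ymgap`, width seat `pub-ymgap-dag-n07-w3` (g19; N07 [B11] ∕ K0⁷ junction).  `--kind proof --supports stmt-QuantumFields-20541 --as helper`,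
COUNT-NEUTRAL.  NEW leaf; theorems only — 0 `def`, 0 `sorry`, 0 `instance`, 0 `notation`; imports three `Literature` modules.
[I] = [Balaban1987RG1]; [III] = [Balaban1988Convergent]; [15] = [Balaban1985Variational].

WHY.  Seat cruxidea-…-20541-3's node `Cruxes/Record13SepCoPHInhabited/RadiusCollapseSketch.lean` (director-ym №424∕№425, CRIT-1 g32 R2 sheet) splits K0⁷'s stub 2′
into a wall (W) at radii `≤ ā` and RADIUS BLINDNESS above `ā`, the latter from (T1) «the [15] antecedents deliver agreement of the background selectors of record
`Uk F 2 K k a V = Uk F 2 K k a' V` on the regular fields» and (T2) `stub_beta13_radiusBlind`: «selector agreement on the `r`-regular fields, `8ε₂₉ ≤ r` ⟹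
`β₁₃(F; a, ε₂₉) = β₁₃(F; a′, ε₂₉)` AS FUNCTIONS».  (T2) is MIS-STATED as typed (this seat's located memo LOCATED-T2-READSET, evidence on 20541): the β of
record reads `A_{k+1}(W) = log((Tρ_k)(1)⁻¹(Tρ_k)(W))` at the germ of the unit configuration with `T = TcanOfRecord = canonVersion ∘ kernelTransport` — a
VERSION-valued transport, pointwise determined by the a.e.-class ONLY on the maximal regular set `regSetOfRecord`; and the (2.9) cutoffs at two radii differ
AS FUNCTIONS off the regular fibres (the selectors are unconstrained there), so the two densities `ρᵃ_k`, `ρᵃ′_k` differ and their transforms agree only a.e.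
on the regular region and pointwise on its intersection with `regSet`.  THIS FILE proves the corrected statement (T2″): radius blindness MODULO the read set —
four displayed row families on an open DOMAIN SYSTEM `U K k ∋ 1`:
(hU) selector agreement ON `U`; (C) `U K (k+1) ⊆ regSetOfRecord F N K k ρᵃ_{K,g,k}` (continuity of the transforms of the `a`-densities on `U`: ONE radius suffices);
(N) the support of the `a`-cutoff over `U_{k+1}` lies in `U_k`; (B) the averaged backgrounds of `U_{k+1}` lie in `U_k` (`AvgBgNest` at radius `a` on `U`).

CONTENTS.  §1 (generic measure theory) LOCALITY OF THE KERNEL TRANSPORT AND OF THE CANONICAL VERSION: two fine densities agreeing over an open coarse set `U`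
have kernel transports agreeing A.E. on `U` (fibre support a.e. + the marginal density vanishes off the image), the same regular points in `U`, and canonical
versions agreeing at EVERY point of `U ∩ regSet`.  §2 the same AT THE RECORD for `TcanOfRecord` (`k < K`).  §3 THE READ-SET INDUCTION, generic in the cutoff
families `χ, χ′` and the radii `ε, ε′`: `A_k` agree on `U_k` (k ≤ K), the merged terms (1.6) agree on `U_{k+1}`, `β_merged` agree, for `T := TcanOfRecord`.
§4 THE (2.9) SPECIES: the cutoffs `chiFix29OfRecord` at two numerics agree over `U` as soon as the selectors at `εreg` do; §6 (v1.1, appended) ROW (C) TRANSFERS along the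
read set: the two β-densities agree over `U_{k+1}`, so their regular sets in `U_{k+1}` coincide and (C) for `χ` IS (C) for `χ′` (the rung of the downward iteration); §5 THE Z3 MEMBER (T2″):
`betaOfRecord₁₃ F N (θ₁₃ᶜᶜᴹᵂᶻᴮ(0; ½; a; 0, ε₂₉; 0, 0, a, 0)) = betaOfRecord₁₃ F N (θ₁₃ᶜᶜᴹᵂᶻᴮ(…a′…))` under (hU)(C)(N)(B) — i.e. seat -3's `betaZB F a ε₂₉ = betaZB F a′ ε₂₉`
(`rfl`-unfolding of `betaZB`).

HONEST FRAMING (binding).  Kernel bookkeeping about the tree's own definitions (a.e.-locality of a disintegration kernel, pointwise determinacy of continuous versions,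
germ locality of the Fréchet derivative, an induction over (0.19)); NO β estimate; nothing of Bałaban's asserted; every row (hU)(C)(N)(B) is a displayed HYPOTHESIS —
(hU) is the node's (T1) (idea-needed), (C) is the continuity-of-the-transform species of row P7 ([I] Thm 1's regularity on `U^c`, wall-adjacent, owed at ONE radius),
(N)(B) are the threshold-hierarchy ∕ background-nesting species ([III] p.265, [I] p.259; n09-lineage tree theorems under numerics) — none is discharged here.  Seat -3's
(T2) AS TYPED is NOT proved (and not claimed): this is its corrected form.  Stub 2′ OPEN; K0⁷ stmt-QuantumFields-20541 NOT closed; N07 NOT discharged; COUNT 8∕28 ·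
K 1∕4 UNMOVED; NODE O = [I] Thm 3 β-clause p.264 — print-proved (claimed), UNPORTED; R4 = the CONDITIONAL finite-𝕋⁴ rung `BalabanLadder.UV` at fixed `ε = L^(−K)` only —
NOT continuum ∕ ℝ⁴ ∕ OS; the Yang–Mills mass gap (Clay) is NOT proved by any of this.  Standard axioms only.
-/

noncomputable section

open MeasureTheory Set Filter
open scoped ENNReal NNReal Matrix.Norms.L2Operator

namespace Summit.QuantumFields.YangMills.BalabanUVNodes.K0Beta13RadiusBlind

open _root_.Topology
open Literature.MathematicalPhysics.QuantumFieldTheory.Balaban1983to89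
open Literature.MathematicalPhysics.QuantumFieldTheory.Balaban1983to89.Node00
open Literature.MathematicalPhysics.QuantumFieldTheory.Balaban1983to89.T4Continuum (T4Family)
open Literature.MathematicalPhysics.QuantumFieldTheory.Balaban1983to89.T4AveragingDisintegration (kernelTransport condLaw margDensity condLaw_fibre_ae
  withDensity_margDensity measurable_margDensity haarAC_iff)
open B12Eq019ActionBody (integrand nextAction normConst integrand_apply nextAction_apply)
open T4FlagMemory (extd)
open B12PolarizationTensor120 (expChart)

/-! ## §1  Locality of the kernel transport (a.e.) and of the canonical version (pointwise on the regular set) — generic -/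

section KernelLocality

variable {α β : Type*} [MeasurableSpace α] [MeasurableSpace β] [StandardBorelSpace β] [Nonempty β] [MeasurableEq α]

/-- **A.E. LOCALITY OF THE KERNEL TRANSPORT**: if two fine densities agree at every fine point whose average lies in the coarse set `U`, their kernel transports
`h(V)·∫ρ dκ_V` agree for `μ`-a.e. `V ∈ U` — for `(ν.map avg)`-a.e. `V` the conditional kernel lives on the fibre over `V` (`condLaw_fibre_ae`), and off the image the
marginal density `h` vanishes `μ`-a.e. (`withDensity_margDensity`).  No measurability of the densities is needed. [folklore] -/
theorem kernelTransport_congr_ae_on (ν : Measure β) [IsFiniteMeasure ν] (μ : Measure α) [SigmaFinite μ] {avg : β → α} (havg : Measurable avg)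
    (hac : ν.map avg ≪ μ) {ρ ρ' : β → ℝ} {U : Set α} (h : ∀ x, avg x ∈ U → ρ x = ρ' x) :
    ∀ᵐ V ∂μ, V ∈ U → kernelTransport ν μ avg ρ V = kernelTransport ν μ avg ρ' V := by
  have hfib : ∀ᵐ V ∂(ν.map avg), condLaw ν avg V {x | avg x = V} = 1 := condLaw_fibre_ae ν havg
  rw [← withDensity_margDensity ν μ havg hac, ae_withDensity_iff measurable_margDensity.coe_nnreal_ennreal] at hfib
  filter_upwards [hfib] with V hV hVU
  unfold kernelTransport
  by_cases h0 : margDensity ν μ avg V = 0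
  · rw [h0, NNReal.coe_zero, zero_mul, zero_mul]
  · have h1 : condLaw ν avg V {x | avg x = V} = 1 := hV (by exact_mod_cast h0)
    have hae : ∀ᵐ x ∂(condLaw ν avg V), avg x = V := by
      have hs : MeasurableSet {x | avg x = V} := measurableSet_eq_fun havg measurable_const
      rw [ae_iff, ← compl_setOf, prob_compl_eq_zero_iff hs]
      exact h1
    rw [integral_congr_ae (hae.mono fun x hx => show ρ x = ρ' x from h x (hx ▸ hVU))]

end KernelLocality

section VersionLocality

variable {α : Type*} [TopologicalSpace α] [MeasurableSpace α] {μ : Measure α}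

/-- **LOCALITY OF THE MAXIMAL REGULAR SET**: two functions a.e. equal on an OPEN set `U` have the same regular points in `U`. [folklore] -/
theorem inter_regSet_eq_of_ae_eq_on [OpensMeasurableSpace α] {f₁ f₂ : α → ℝ} {U : Set α} (hU : IsOpen U) (h : ∀ᵐ x ∂μ, x ∈ U → f₁ x = f₂ x) :
    U ∩ regSet μ f₁ = U ∩ regSet μ f₂ := by
  have key : ∀ {g₁ g₂ : α → ℝ}, (∀ᵐ x ∂μ, x ∈ U → g₁ x = g₂ x) → U ∩ regSet μ g₁ ⊆ U ∩ regSet μ g₂ := by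
    intro g₁ g₂ hg x hx
    obtain ⟨O, hO, hxO, gO, hgO, haeO⟩ := mem_regSet_iff.1 hx.2
    refine ⟨hx.1, mem_regSet_iff.2 ⟨O ∩ U, hO.inter hU, ⟨hxO, hx.1⟩, gO, hgO.mono inter_subset_left, ?_⟩⟩
    have h1 : gO =ᵐ[μ.restrict (O ∩ U)] g₁ := ae_restrict_of_ae_restrict_of_subset inter_subset_left haeO
    have h2 : ∀ᵐ x ∂μ.restrict (O ∩ U), g₁ x = g₂ x := by
      rw [ae_restrict_iff' (hO.inter hU).measurableSet]
      exact hg.mono fun x hx hxOU => hx hxOU.2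
    exact h1.trans h2
  refine Subset.antisymm (key h) (key (h.mono fun x hx hxU => (hx hxU).symm))

/-- **POINTWISE LOCALITY OF THE CANONICAL VERSION ON THE REGULAR SET**: two functions a.e. equal on an open set `U` have canonical versions agreeing at EVERY
point of `U ∩ regSet` (both are continuous there and a.e. equal to the common class: determinacy `Measure.eqOn_open_of_ae_eq`). [folklore] -/
theorem canonVersion_eqOn_inter_regSet_of_ae_eq_on [SecondCountableTopology α] [OpensMeasurableSpace α] [μ.IsOpenPosMeasure] {f₁ f₂ : α → ℝ}
    {U : Set α} (hU : IsOpen U) (h : ∀ᵐ x ∂μ, x ∈ U → f₁ x = f₂ x) :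
    EqOn (canonVersion μ f₁) (canonVersion μ f₂) (U ∩ regSet μ f₁) := by
  have hO : IsOpen (U ∩ regSet μ f₁) := hU.inter isOpen_regSet
  have hc₁ : ContinuousOn (canonVersion μ f₁) (U ∩ regSet μ f₁) := (continuousOn_canonVersion (μ := μ) (f := f₁)).mono inter_subset_right
  have hc₂ : ContinuousOn (canonVersion μ f₂) (U ∩ regSet μ f₁) := by
    rw [inter_regSet_eq_of_ae_eq_on hU h]
    exact (continuousOn_canonVersion (μ := μ) (f := f₂)).mono inter_subset_right
  refine Measure.eqOn_open_of_ae_eq (μ := μ) ?_ hO hc₁ hc₂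
  have h1 : canonVersion μ f₁ =ᵐ[μ.restrict (U ∩ regSet μ f₁)] f₁ := ae_restrict_of_ae canonVersion_ae_eq
  have h2 : canonVersion μ f₂ =ᵐ[μ.restrict (U ∩ regSet μ f₁)] f₂ := ae_restrict_of_ae canonVersion_ae_eq
  have h12 : f₁ =ᵐ[μ.restrict (U ∩ regSet μ f₁)] f₂ := by
    rw [Filter.EventuallyEq, ae_restrict_iff' hO.measurableSet]
    exact h.mono fun x hx hxU => hx hxU.1
  exact h1.trans (h12.trans h2.symm)

end VersionLocality

/-! ## §2  At the record: locality of `TcanOfRecord` (`k < K`) -/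

section RecordLocality

variable {F : T4Family} {N : ℕ} [NeZero N]

/-- **THE TRANSFORMS OF RECORD OF TWO DENSITIES AGREEING OVER AN OPEN COARSE SET agree a.e. there** (`k < K`: Haar absolute continuity of the averaging of record).
[cite: Balaban1987RG1, (0.13) p.254; Balaban1988Convergent, (3.1) p.264 (bookkeeping)] -/
theorem transportOfRecord_congr_ae_on {K k : ℕ} (hk : k < K) {ρ ρ' : Density (F.P K) k (Node00.SU N)} {U : Set (PBond (F.P K) (k + 1) → Node00.SU N)}
    (h : ∀ V, (avOfRecord F N K k).avg V ∈ U → ρ V = ρ' V) :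
    ∀ᵐ W ∂(piHaar (F.P K) (k + 1) (Node00.SU N)), W ∈ U →
      (fun W : PBond (F.P K) (k + 1) → Node00.SU N => transportOfRecord F N K k ρ W) W = (fun W : PBond (F.P K) (k + 1) → Node00.SU N => transportOfRecord F N K k ρ' W) W :=
  kernelTransport_congr_ae_on _ _ (avOfRecord_measurable F N K k) ((haarAC_iff _).1 (avOfRecord_haarAC F N K k hk)) h

/-- **… hence they have the same regular points in `U`** … [cite: Balaban1987RG1, (0.13) p.254 (bookkeeping)] -/
theorem inter_regSetOfRecord_eq {K k : ℕ} (hk : k < K) {ρ ρ' : Density (F.P K) k (Node00.SU N)} {U : Set (PBond (F.P K) (k + 1) → Node00.SU N)} (hU : IsOpen U)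
    (h : ∀ V, (avOfRecord F N K k).avg V ∈ U → ρ V = ρ' V) :
    U ∩ regSetOfRecord F N K k ρ = U ∩ regSetOfRecord F N K k ρ' :=
  inter_regSet_eq_of_ae_eq_on (α := PBond (F.P K) (k + 1) → Node00.SU N) hU (transportOfRecord_congr_ae_on hk h)

/-- **… and `TcanOfRecord` takes the same value at EVERY point of `U ∩ regSetOfRecord`.** [cite: Balaban1987RG1, (0.13) p.254 and (0.19) p.255 (bookkeeping)] -/
theorem TcanOfRecord_eqOn_of_eq_over {K k : ℕ} (hk : k < K) {ρ ρ' : Density (F.P K) k (Node00.SU N)} {U : Set (PBond (F.P K) (k + 1) → Node00.SU N)} (hU : IsOpen U)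
    (h : ∀ V, (avOfRecord F N K k).avg V ∈ U → ρ V = ρ' V) :
    EqOn (TcanOfRecord F N K k ρ) (TcanOfRecord F N K k ρ') (U ∩ regSetOfRecord F N K k ρ) :=
  haveI := isOpenPosMeasure_piHaar_SUN N (F.P K) (k + 1)
  canonVersion_eqOn_inter_regSet_of_ae_eq_on (α := PBond (F.P K) (k + 1) → Node00.SU N) hU (transportOfRecord_congr_ae_on hk h)

end RecordLocality

/-! ## §3  The read-set induction over (0.19) for `T := TcanOfRecord`, generic in the cutoffs `χ, χ′` and the background radii `ε, ε′` -/

section ReadSet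

variable {F : T4Family} {N : ℕ} [NeZero N]

/-- **THE EFFECTIVE ACTIONS AGREE ON THE DOMAIN SYSTEM** (`A_k^{χ} = A_k^{χ′}` on `U K k`, `k ≤ K`): by induction over (0.19) — `A_0 = −A∕g_0²` reads nothing;
at `k + 1` the two integrands `χ_k·e^{−GF∕g_k² + A_k}` AGREE OVER `U K (k+1)` (cutoffs agree there (hχ); where the cutoff is non-zero the point lies in `U K k` (hN),
where the `A_k` agree by induction), so their canonical-version transforms agree at every point of `U K (k+1) ∩ regSet = U K (k+1)` (§2 + the continuity row (hC)),
in particular at `W` and at the unit configuration (normalisation `𝐍_k`). [cite: Balaban1987RG1, (0.17)–(0.19) p.255, p.259 (bookkeeping)] -/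
theorem effActionHT_Tcan_eqOn_of_readSet (χ χ' : (K : ℕ) → (ℕ → ℝ) → (k : ℕ) → Density (F.P K) k (Node00.SU N))
    (U : (K k : ℕ) → Set (GaugeField (F.P K) k (Node00.SU N))) (hUo : ∀ K k, IsOpen (U K k)) (hU1 : ∀ K k, (1 : GaugeField (F.P K) k (Node00.SU N)) ∈ U K k)
    (K : ℕ) (g : ℕ → ℝ)
    (hχ : ∀ k V, k < K → (avOfRecord F N K k).avg V ∈ U K (k + 1) → χ K g k V = χ' K g k V)
    (hN : ∀ k V, k < K → (avOfRecord F N K k).avg V ∈ U K (k + 1) → χ K g k V ≠ 0 → V ∈ U K k)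
    (hC : ∀ k, k < K → U K (k + 1) ⊆ regSetOfRecord F N K k
      (integrand (χ K g k) (gfOfRecord F N K k) (g k) (effActionHT F N (TcanOfRecord F N) χ K g k))) :
    ∀ k, k ≤ K → EqOn (effActionHT F N (TcanOfRecord F N) χ K g k) (effActionHT F N (TcanOfRecord F N) χ' K g k) (U K k)
  | 0, _ => fun V _ => by rw [effActionHT_zero, effActionHT_zero]
  | k + 1, hk => by
    have hk' : k < K := Nat.lt_of_succ_le hk
    have ih := effActionHT_Tcan_eqOn_of_readSet χ χ' U hUo hU1 K g hχ hN hC k hk'.le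
    -- the two level-k integrands agree over U K (k+1)
    have hρ : ∀ V, (avOfRecord F N K k).avg V ∈ U K (k + 1) →
        integrand (χ K g k) (gfOfRecord F N K k) (g k) (effActionHT F N (TcanOfRecord F N) χ K g k) V =
          integrand (χ' K g k) (gfOfRecord F N K k) (g k) (effActionHT F N (TcanOfRecord F N) χ' K g k) V := by
      intro V hV
      rw [integrand_apply, integrand_apply, ← hχ k V hk' hV]
      by_cases hz : χ K g k V = 0
      · rw [hz, zero_mul, zero_mul]
      · rw [ih (hN k V hk' hV hz)]
    have hT : EqOn
        (TcanOfRecord F N K k (integrand (χ K g k) (gfOfRecord F N K k) (g k) (effActionHT F N (TcanOfRecord F N) χ K g k)))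
        (TcanOfRecord F N K k (integrand (χ' K g k) (gfOfRecord F N K k) (g k) (effActionHT F N (TcanOfRecord F N) χ' K g k)))
        (U K (k + 1)) := fun W hW =>
      TcanOfRecord_eqOn_of_eq_over hk' (hUo K (k + 1)) hρ ⟨hW, hC k hk' hW⟩
    intro W hW
    rw [effActionHT_succ, effActionHT_succ, nextAction_apply, nextAction_apply, B12Eq019ActionBody.normConst_def, B12Eq019ActionBody.normConst_def,
      hT hW, hT (hU1 K (k + 1))]

/-- **THE MERGED TERMS (1.6) AGREE ON `U K (k+1)`** (`k + 1 ≤ K`): the first summands by the previous theorem; the backgrounds `U_{k+1}(ε; W) = U_{k+1}(ε′; W)` by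
selector agreement (hbg); the second summands are `A_k` at the averaged background, which lies in `U K k` by the nesting row (hB).
[cite: Balaban1987RG1, (1.6) p.261, (0.23) p.256 (bookkeeping)] -/
theorem mergedTermT_Tcan_eqOn_of_readSet (χ χ' : (K : ℕ) → (ℕ → ℝ) → (k : ℕ) → Density (F.P K) k (Node00.SU N)) (ε ε' : ℝ)
    (U : (K k : ℕ) → Set (GaugeField (F.P K) k (Node00.SU N))) (hUo : ∀ K k, IsOpen (U K k)) (hU1 : ∀ K k, (1 : GaugeField (F.P K) k (Node00.SU N)) ∈ U K k)
    (K : ℕ) (g : ℕ → ℝ)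
    (hχ : ∀ k V, k < K → (avOfRecord F N K k).avg V ∈ U K (k + 1) → χ K g k V = χ' K g k V)
    (hN : ∀ k V, k < K → (avOfRecord F N K k).avg V ∈ U K (k + 1) → χ K g k V ≠ 0 → V ∈ U K k)
    (hC : ∀ k, k < K → U K (k + 1) ⊆ regSetOfRecord F N K k
      (integrand (χ K g k) (gfOfRecord F N K k) (g k) (effActionHT F N (TcanOfRecord F N) χ K g k)))
    (hbg : ∀ k W, k < K → W ∈ U K (k + 1) → Uk F N K (k + 1) ε W = Uk F N K (k + 1) ε' W)
    (hB : ∀ k W, k < K → W ∈ U K (k + 1) → Averaging.iter (avOfRecord F N K) k (Uk F N K (k + 1) ε W) ∈ U K k)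
    {k : ℕ} (hk : k + 1 ≤ K) :
    EqOn (mergedTermT F N (TcanOfRecord F N) χ ε K g k) (mergedTermT F N (TcanOfRecord F N) χ' ε' K g k) (U K (k + 1)) := by
  intro W hW
  have hk' : k < K := Nat.lt_of_succ_le hk
  have hA := effActionHT_Tcan_eqOn_of_readSet χ χ' U hUo hU1 K g hχ hN hC
  unfold mergedTermT
  rw [hA (k + 1) hk hW, ← hbg k W hk' hW, hA k hk'.le (hB k W hk' hW)]

/-- **THE MERGED β AGREE** (every level, every history): `β_merged` at level `k` reads only the germs at `B = 0` of the charts of the merged terms on the large tori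
(`betaMerged_congr_at`); the chart field tends to the unit configuration, an interior point of `U K (k+1)` — where the merged terms agree.
[cite: Balaban1987RG1, (1.20)–(1.22) p.264, (1.6) p.261 (bookkeeping)] -/
theorem betaMerged_Tcan_eq_of_readSet {V : Type*} [NormedAddCommGroup V] [NormedSpace ℝ V] {ι : Type*} [Fintype ι]
    (ρm : V →L[ℝ] Matrix (Fin N) (Fin N) ℂ) (bV : Module.Basis ι ℝ V)
    (χ χ' : (K : ℕ) → (ℕ → ℝ) → (k : ℕ) → Density (F.P K) k (Node00.SU N)) (ε ε' : ℝ)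
    (U : (K k : ℕ) → Set (GaugeField (F.P K) k (Node00.SU N))) (hUo : ∀ K k, IsOpen (U K k)) (hU1 : ∀ K k, (1 : GaugeField (F.P K) k (Node00.SU N)) ∈ U K k)
    (hχ : ∀ K (g : ℕ → ℝ) k V, k < K → (avOfRecord F N K k).avg V ∈ U K (k + 1) → χ K g k V = χ' K g k V)
    (hN : ∀ K (g : ℕ → ℝ) k V, k < K → (avOfRecord F N K k).avg V ∈ U K (k + 1) → χ K g k V ≠ 0 → V ∈ U K k)
    (hC : ∀ K (g : ℕ → ℝ) k, k < K → U K (k + 1) ⊆ regSetOfRecord F N K k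
      (integrand (χ K g k) (gfOfRecord F N K k) (g k) (effActionHT F N (TcanOfRecord F N) χ K g k)))
    (hbg : ∀ K k W, k < K → W ∈ U K (k + 1) → Uk F N K (k + 1) ε W = Uk F N K (k + 1) ε' W)
    (hB : ∀ K k W, k < K → W ∈ U K (k + 1) → Averaging.iter (avOfRecord F N K) k (Uk F N K (k + 1) ε W) ∈ U K k) :
    betaMerged F (mergedTermFamilyMatT F N (TcanOfRecord F N) χ ε) ρm bV = betaMerged F (mergedTermFamilyMatT F N (TcanOfRecord F N) χ' ε') ρm bV := by
  funext k
  refine betaMerged_congr_at F ρm bV fun hist => (eventually_gt_atTop (k + 1)).mono fun K hK => ?_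
  have hmem : ∀ᶠ B in 𝓝 (0 : Fin (F.P K).d → Site (F.P K) (k + 1) → V), chartField F N ρm K (k + 1) B ∈ U K (k + 1) :=
    tendsto_chartField_zero F N ρm K (k + 1) ((hUo K (k + 1)).mem_nhds (hU1 K (k + 1)))
  exact hmem.mono fun B hBm => by
    rw [expChart_mergedTermFamilyMatT, expChart_mergedTermFamilyMatT]
    exact mergedTermT_Tcan_eqOn_of_readSet χ χ' ε ε' U hUo hU1 K (extd hist) (hχ K _) (hN K _) (hC K _) (hbg K) (hB K) hK.le hBm

end ReadSet

/-! ## §4  The (2.9) species: the cutoffs of record at two numerics agree wherever the background selectors at `εreg` do -/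

section Species

variable {F : T4Family} {N : ℕ} [NeZero N]

/-- **`χ^{(2.9)}_k` READS THE RADIUS LETTER ONLY THROUGH THE SELECTOR `U_{k+1}(εreg; V̄)`**: two Stage-7 numerics whose background selectors of record agree at the
average of `V` give the same critical configuration `V^{(k)}(V̄)` (2.3), the same fluctuation variables and the same value of the printed cutoff (2.9) at `V` — for every
threshold `ε₁`. [cite: Balaban1987RG1, (2.3) p.265, (2.9) p.266 (bookkeeping)] -/
theorem chiFix29OfRecord_congr_of_Uk_eq {ν ν' : Stage7Numerics} (ε₁ : ℝ) {K k : ℕ} {V : GaugeField (F.P K) k (Node00.SU N)}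
    (h : Uk F N K (k + 1) ν.εreg ((avOfRecord F N K k).avg V) = Uk F N K (k + 1) ν'.εreg ((avOfRecord F N K k).avg V)) :
    chiFix29OfRecord F N ν ε₁ K k V = chiFix29OfRecord F N ν' ε₁ K k V := by
  have hc : critCfgOfRecord F N ν K k ((avOfRecord F N K k).avg V) = critCfgOfRecord F N ν' K k ((avOfRecord F N K k).avg V) := by
    rw [critCfgOfRecord_def, critCfgOfRecord_def, h]
  have hf : ∀ b, fluctDevOfRecord F N ν K k V b = fluctDevOfRecord F N ν' K k V b := fun b => by
    rw [fluctDevOfRecord_apply, fluctDevOfRecord_apply, hc]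
  have hiff : chiFix29OfRecord F N ν ε₁ K k V = 1 ↔ chiFix29OfRecord F N ν' ε₁ K k V = 1 := by
    rw [chiFix29OfRecord_eq_one_iff, chiFix29OfRecord_eq_one_iff]
    exact forall_congr' fun b => by rw [hf b]
  rcases chiFix29OfRecord_eq_zero_or_one ν ε₁ K k V with h0 | h1
  · rcases chiFix29OfRecord_eq_zero_or_one ν' ε₁ K k V with h0' | h1'
    · rw [h0, h0']
    · exact absurd (h0.symm.trans (hiff.2 h1')) zero_ne_one
  · rw [h1, hiff.1 h1]

/-- … hence the β-slot families `chiFixed29` agree at `V` (any coupling history, any threshold). [cite: Balaban1987RG1, (2.9) p.266 (bookkeeping)] -/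
theorem chiFixed29_congr_of_Uk_eq {ν ν' : Stage7Numerics} (ε₁ : ℝ) {K k : ℕ} (g : ℕ → ℝ) {V : GaugeField (F.P K) k (Node00.SU N)}
    (h : Uk F N K (k + 1) ν.εreg ((avOfRecord F N K k).avg V) = Uk F N K (k + 1) ν'.εreg ((avOfRecord F N K k).avg V)) :
    chiFixed29 F N ν ε₁ K g k V = chiFixed29 F N ν' ε₁ K g k V := by
  rw [chiFixed29_apply, chiFixed29_apply]
  exact chiFix29OfRecord_congr_of_Uk_eq ε₁ h

end Species

/-! ## §5  (T2″) — RADIUS BLINDNESS OF THE β OF RECORD AT THE PRINT-REGIME Z3 MEMBERS, MODULO THE READ SET -/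

section ZB

variable (F : T4Family) (N : ℕ) [NeZero N]

/-- **(T2″) — THE β OF RECORD AT TWO PRINT-REGIME Z3 MEMBERS `θ₁₃ᶜᶜᴹᵂᶻᴮ(j; γ; εbg := a; ε₀, ε₂₉; B₃, B₃′, a, a₁; Efl, logz)` and `(… a′ …)` COINCIDE AS FUNCTIONS, MODULO THE READ
SET.**  Displayed rows on an open domain system `U K k ∋ 1` of the configuration spaces: (hU) the background selectors of record at the two radii agree ON `U` (the node's
(T1): [15] Thm 1 (8)–(10) at one radius + choice rigidity); (hC) on `U K (k+1)` the transform of record of the level-`k` β-density of the `a`-member has a continuous version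
(`U K (k+1) ⊆ regSetOfRecord`; the continuity-of-the-transform species of row P7 — ONE radius); (hN) a field whose average lies in `U K (k+1)` and at which the `a`-member's
cutoff (2.9) does not vanish lies in `U K k` (threshold hierarchy [III] p.265 + the p.267 rider); (hB) the `k`-fold average of the radius-`a` background of a field of `U K (k+1)`
lies in `U K k` (nesting of the small-field domains under the background map, [I] p.259).  Under them the two members have THE SAME β (every level, every history): the radius
letter is read only through the selectors on `U`.  This is the corrected form of seat cruxidea-…-20541-3's `stub_beta13_radiusBlind` (whose conclusion `betaZB F a ε₂₉ = betaZB F a′ ε₂₉`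
is the member `j = 0, γ = ½, ε₀ = B₃ = B₃′ = a₁ = 0, Efl = logz = 0` of this statement by unfolding); the stub AS TYPED (selector agreement on the `r`-regular fields and `8ε₂₉ ≤ r` only)
is NOT proved here. [cite: Balaban1987RG1, (1.20)–(1.22) p.264, (1.6) p.261, (0.19) p.255, (0.21) p.256, p.259, (2.9) p.266; Balaban1985Variational, Thm 1 (8)–(10) p.279; Balaban1988Convergent, p.265 (bookkeeping)] -/
theorem betaOfRecord₁₃_thm1CCMWZB_radiusBlind_of_readSet (j : ℕ) (γ ε₀ ε₂₉ B₃ B₃' a₁ a a' : ℝ) (Efl logz : B12.RunParams → ℕ → ℝ)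
    (U : (K k : ℕ) → Set (GaugeField (F.P K) k (Node00.SU N))) (hUo : ∀ K k, IsOpen (U K k)) (hU1 : ∀ K k, (1 : GaugeField (F.P K) k (Node00.SU N)) ∈ U K k)
    (hU : ∀ K k W, k < K → W ∈ U K (k + 1) → Uk F N K (k + 1) a W = Uk F N K (k + 1) a' W)
    (hC : ∀ K (g : ℕ → ℝ) k, k < K → U K (k + 1) ⊆ regSetOfRecord F N K k
      (integrand (chiFixed29 F N (numerics7OfThm1CCM F.L j ε₀ B₃ B₃' a a₁) ε₂₉ K g k) (gfOfRecord F N K k) (g k)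
        (effActionHT F N (TcanOfRecord F N) (chiFixed29 F N (numerics7OfThm1CCM F.L j ε₀ B₃ B₃' a a₁) ε₂₉) K g k)))
    (hN : ∀ K k V, k < K → (avOfRecord F N K k).avg V ∈ U K (k + 1) → chiFix29OfRecord F N (numerics7OfThm1CCM F.L j ε₀ B₃ B₃' a a₁) ε₂₉ K k V ≠ 0 → V ∈ U K k)
    (hB : ∀ K k W, k < K → W ∈ U K (k + 1) → Averaging.iter (avOfRecord F N K) k (Uk F N K (k + 1) a W) ∈ U K k) :
    betaOfRecord₁₃ F N (theta13OfThm1CCMWZB F N j γ a ε₀ ε₂₉ B₃ B₃' a a₁ Efl logz) =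
      betaOfRecord₁₃ F N (theta13OfThm1CCMWZB F N j γ a' ε₀ ε₂₉ B₃ B₃' a' a₁ Efl logz) := by
  set θ := theta13OfThm1CCMWZB F N j γ a ε₀ ε₂₉ B₃ B₃' a a₁ Efl logz with hθ
  letI := θ.instVβ₁; letI := θ.instVβ₂; letI := θ.instιβ
  have hm : betaMerged F (mergedTermFamilyMatT F N (TcanOfRecord F N) (chiFixed29 F N (numerics7OfThm1CCM F.L j ε₀ B₃ B₃' a a₁) ε₂₉) a) θ.ρ8 θ.bV =
      betaMerged F (mergedTermFamilyMatT F N (TcanOfRecord F N) (chiFixed29 F N (numerics7OfThm1CCM F.L j ε₀ B₃ B₃' a' a₁) ε₂₉) a') θ.ρ8 θ.bV :=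
    betaMerged_Tcan_eq_of_readSet θ.ρ8 θ.bV _ _ a a' U hUo hU1
      (fun K g k V hk hV => chiFixed29_congr_of_Uk_eq ε₂₉ g (hU K k _ hk hV))
      (fun K g k V hk hV hz => hN K k V hk hV (by rwa [chiFixed29_apply] at hz)) hC hU hB
  funext k
  exact betaOfMerged_congr_at θ.γ (congrFun hm k) (beta0OfMerged_congr_at θ.v₀ (congrFun hm k))

/-- **(T2″) IN THE NODE'S LETTERS** — the member `betaZB F a ε₂₉ := betaOfRecord₁₃ F N (θ₁₃ᶜᶜᴹᵂᶻᴮ(0; ½; a; 0, ε₂₉; 0, 0, a, 0; 0, 0))` of seat -3's sketch, with the selector agreement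
supplied in the shape of its `SelectorsAgreeOn F N a a′ r` («on the `r`-regular fields of every level of every torus») and the domain system INSIDE the `r`-regular fields: then rows
(hC)(hN)(hB) on `U` give `betaZB F a ε₂₉ = betaZB F a′ ε₂₉` (by unfolding).  The rows are NOT discharged; `8ε₂₉ ≤ r` plays no role. [cite: Balaban1987RG1, (1.20)–(1.22) p.264, (2.9) p.266, (0.21) p.256; Balaban1985Variational, Thm 1 (8)–(10) p.279 (bookkeeping)] -/
theorem betaOfRecord₁₃_zb_radiusBlind_of_selectorsAgreeOn (ε₂₉ a a' r : ℝ)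
    (hUr : ∀ (K k : ℕ) (V : GaugeField (F.P K) k (Node00.SU N)), PlaqSmall r V → Uk F N K k a V = Uk F N K k a' V)
    (U : (K k : ℕ) → Set (GaugeField (F.P K) k (Node00.SU N))) (hUo : ∀ K k, IsOpen (U K k)) (hU1 : ∀ K k, (1 : GaugeField (F.P K) k (Node00.SU N)) ∈ U K k)
    (hsub : ∀ K k, U K k ⊆ {V | PlaqSmall r V})
    (hC : ∀ K (g : ℕ → ℝ) k, k < K → U K (k + 1) ⊆ regSetOfRecord F N K k
      (integrand (chiFixed29 F N (numerics7OfThm1CCM F.L 0 0 0 0 a 0) ε₂₉ K g k) (gfOfRecord F N K k) (g k)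
        (effActionHT F N (TcanOfRecord F N) (chiFixed29 F N (numerics7OfThm1CCM F.L 0 0 0 0 a 0) ε₂₉) K g k)))
    (hN : ∀ K k V, k < K → (avOfRecord F N K k).avg V ∈ U K (k + 1) → chiFix29OfRecord F N (numerics7OfThm1CCM F.L 0 0 0 0 a 0) ε₂₉ K k V ≠ 0 → V ∈ U K k)
    (hB : ∀ K k W, k < K → W ∈ U K (k + 1) → Averaging.iter (avOfRecord F N K) k (Uk F N K (k + 1) a W) ∈ U K k) :
    betaOfRecord₁₃ F N (theta13OfThm1CCMWZB F N 0 (1 / 2) a 0 ε₂₉ 0 0 a 0 (fun _ _ => 0) (fun _ _ => 0)) =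
      betaOfRecord₁₃ F N (theta13OfThm1CCMWZB F N 0 (1 / 2) a' 0 ε₂₉ 0 0 a' 0 (fun _ _ => 0) (fun _ _ => 0)) :=
  betaOfRecord₁₃_thm1CCMWZB_radiusBlind_of_readSet F N 0 (1 / 2) 0 ε₂₉ 0 0 0 a a' _ _ U hUo hU1
    (fun K k W _ hW => hUr K (k + 1) W (hsub K (k + 1) hW)) hC hN hB

end ZB

/-! ## §6  (v1.1) Row (C) TRANSFERS along the read set: the β-densities agree over `U`, so their regular sets in `U` coincide -/

section Transfer

variable {F : T4Family} {N : ℕ} [NeZero N]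

/-- **THE TWO β-DENSITIES AGREE OVER `U K (k+1)`** (`k < K`; the inner step of `effActionHT_Tcan_eqOn_of_readSet`, exported): at every fine field whose average lies in `U K (k+1)`
the level-`k` integrands `χ_k·e^{−GF∕g_k² + A_k}` over `χ` and over `χ′` coincide (cutoffs agree there; where the cutoff is non-zero the point lies in `U K k`, where the `A_k` agree).
[cite: Balaban1987RG1, (0.19) p.255 (bookkeeping)] -/
theorem integrand_Tcan_eq_over_of_readSet (χ χ' : (K : ℕ) → (ℕ → ℝ) → (k : ℕ) → Density (F.P K) k (Node00.SU N))
    (U : (K k : ℕ) → Set (GaugeField (F.P K) k (Node00.SU N))) (hUo : ∀ K k, IsOpen (U K k)) (hU1 : ∀ K k, (1 : GaugeField (F.P K) k (Node00.SU N)) ∈ U K k)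
    (K : ℕ) (g : ℕ → ℝ)
    (hχ : ∀ k V, k < K → (avOfRecord F N K k).avg V ∈ U K (k + 1) → χ K g k V = χ' K g k V)
    (hN : ∀ k V, k < K → (avOfRecord F N K k).avg V ∈ U K (k + 1) → χ K g k V ≠ 0 → V ∈ U K k)
    (hC : ∀ k, k < K → U K (k + 1) ⊆ regSetOfRecord F N K k
      (integrand (χ K g k) (gfOfRecord F N K k) (g k) (effActionHT F N (TcanOfRecord F N) χ K g k)))
    {k : ℕ} (hk : k < K) :
    ∀ V, (avOfRecord F N K k).avg V ∈ U K (k + 1) →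
      integrand (χ K g k) (gfOfRecord F N K k) (g k) (effActionHT F N (TcanOfRecord F N) χ K g k) V =
        integrand (χ' K g k) (gfOfRecord F N K k) (g k) (effActionHT F N (TcanOfRecord F N) χ' K g k) V := by
  intro V hV
  have ih := effActionHT_Tcan_eqOn_of_readSet χ χ' U hUo hU1 K g hχ hN hC k hk.le
  rw [integrand_apply, integrand_apply, ← hχ k V hk hV]
  by_cases hz : χ K g k V = 0
  · rw [hz, zero_mul, zero_mul]
  · rw [ih (hN k V hk hV hz)]

/-- **THE REGULAR SETS OF THE TWO β-DENSITIES COINCIDE IN `U K (k+1)`** (`k < K`): same a.e.-class of the transform there (§2). [cite: Balaban1987RG1, (0.13) p.254 (bookkeeping)] -/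
theorem inter_regSetOfRecord_eq_of_readSet (χ χ' : (K : ℕ) → (ℕ → ℝ) → (k : ℕ) → Density (F.P K) k (Node00.SU N))
    (U : (K k : ℕ) → Set (GaugeField (F.P K) k (Node00.SU N))) (hUo : ∀ K k, IsOpen (U K k)) (hU1 : ∀ K k, (1 : GaugeField (F.P K) k (Node00.SU N)) ∈ U K k)
    (K : ℕ) (g : ℕ → ℝ)
    (hχ : ∀ k V, k < K → (avOfRecord F N K k).avg V ∈ U K (k + 1) → χ K g k V = χ' K g k V)
    (hN : ∀ k V, k < K → (avOfRecord F N K k).avg V ∈ U K (k + 1) → χ K g k V ≠ 0 → V ∈ U K k)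
    (hC : ∀ k, k < K → U K (k + 1) ⊆ regSetOfRecord F N K k
      (integrand (χ K g k) (gfOfRecord F N K k) (g k) (effActionHT F N (TcanOfRecord F N) χ K g k)))
    {k : ℕ} (hk : k < K) :
    (U K (k + 1) : Set (PBond (F.P K) (k + 1) → Node00.SU N)) ∩ regSetOfRecord F N K k
        (integrand (χ K g k) (gfOfRecord F N K k) (g k) (effActionHT F N (TcanOfRecord F N) χ K g k)) =
      (U K (k + 1) : Set (PBond (F.P K) (k + 1) → Node00.SU N)) ∩ regSetOfRecord F N K k
        (integrand (χ' K g k) (gfOfRecord F N K k) (g k) (effActionHT F N (TcanOfRecord F N) χ' K g k)) :=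
  inter_regSetOfRecord_eq hk (hUo K (k + 1)) (integrand_Tcan_eq_over_of_readSet χ χ' U hUo hU1 K g hχ hN hC hk)

/-- **ROW (C) TRANSFERS**: under the read-set rows for `(χ, χ′)` on `U`, the continuity row (C) for `χ` IS the continuity row for `χ′` — the rung that lets radius blindness be
ITERATED (the second radius inherits the first's regular sets on `U`, so it can serve as the base radius of the next step without a new continuity input).
[cite: Balaban1987RG1, (0.13) p.254 and (0.19) p.255 (bookkeeping)] -/
theorem rowC_transfer_of_readSet (χ χ' : (K : ℕ) → (ℕ → ℝ) → (k : ℕ) → Density (F.P K) k (Node00.SU N))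
    (U : (K k : ℕ) → Set (GaugeField (F.P K) k (Node00.SU N))) (hUo : ∀ K k, IsOpen (U K k)) (hU1 : ∀ K k, (1 : GaugeField (F.P K) k (Node00.SU N)) ∈ U K k)
    (K : ℕ) (g : ℕ → ℝ)
    (hχ : ∀ k V, k < K → (avOfRecord F N K k).avg V ∈ U K (k + 1) → χ K g k V = χ' K g k V)
    (hN : ∀ k V, k < K → (avOfRecord F N K k).avg V ∈ U K (k + 1) → χ K g k V ≠ 0 → V ∈ U K k)
    (hC : ∀ k, k < K → U K (k + 1) ⊆ regSetOfRecord F N K k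
      (integrand (χ K g k) (gfOfRecord F N K k) (g k) (effActionHT F N (TcanOfRecord F N) χ K g k))) :
    ∀ k, k < K → U K (k + 1) ⊆ regSetOfRecord F N K k
      (integrand (χ' K g k) (gfOfRecord F N K k) (g k) (effActionHT F N (TcanOfRecord F N) χ' K g k)) := by
  intro k hk W hW
  have h := inter_regSetOfRecord_eq_of_readSet χ χ' U hUo hU1 K g hχ hN hC hk
  have hW' : W ∈ (U K (k + 1) : Set (PBond (F.P K) (k + 1) → Node00.SU N)) ∩ regSetOfRecord F N K k
      (integrand (χ K g k) (gfOfRecord F N K k) (g k) (effActionHT F N (TcanOfRecord F N) χ K g k)) := ⟨hW, hC k hk hW⟩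
  rw [h] at hW'
  exact hW'.2

end Transfer

end Summit.QuantumFields.YangMills.BalabanUVNodes.K0Beta13RadiusBlind
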